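import Summits.QuantumFields.YangMills.Theorems.ColdStartUniversalityLatticeLangevinWilsonGapUpperBound
import HarnessLib

/-!
# Route `ColdStartUniversality` (fixed-cut-off package): SINGLE-LINK MARGINALS OF THE WILSON MEASURE ARE HAAR (`L ≥ 2`, every `β'`)

Helper file (seat `ym-line-csu-p1`, g19; `--supports stmt-QuantumFields-27363`).  Elitzur-type fact behind the gauge-mode test functions of
`…WilsonGapUpperBound`: for the SU(2) Wilson measure `μ_{β'}` on the torus `(ℤ/L)³` with `L ≥ 2` (so that every link has two distinct
endpoints) and every link `e`, the law of the single link variable `V_e` is the Haar probability measure, at EVERY coupling: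
`∫ φ(V_e) dμ_{β'}(V) = ∫ φ dHaar` for continuous `φ`.  Proof: `μ_{β'}` is invariant under the gauge transformation `γ = 1` except `γ(x) = h`
at the source `x` of `e` (`wilsonMeasure_map_gaugeTransform_holds`), which maps `V_e ↦ h·V_e`; average over `h` w.r.t. Haar (Fubini) and use
right invariance of Haar.  (For `L = 1` the statement is false: every link is a loop and only conjugation invariance survives.)

* ★ `integral_link_eq_integral_mul_left` — `∫ φ(V_e) dμ_{β'} = ∫ φ(h·V_e) dμ_{β'}` for every `h ∈ SU(2)`;
* ★★ `integral_link_eq_haar` — `∫ φ(V_e) dμ_{β'} = ∫ φ dHaar` (continuous `φ`);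
* ★ `integral_link_eq_beta_zero` — in particular single-link expectations do not depend on `β'`: `∫ φ(V_e) dμ_{β'} = ∫ φ(V_e) dμ_0`.

THEOREMS ONLY, no definition, no sorry.  HONEST FRAMING: RECORD-rung R3 plumbing at FIXED cut-off (a classical consequence of local gauge
invariance, cf. Elitzur's theorem in `Literature/Barriers/QuantumFields/ElitzurTheorem`); nothing K-uniform; no crux, rung or summit
statement is proved; the Yang–Mills mass gap is NOT proved.
-/

set_option autoImplicit false

noncomputable section

namespace Summit.QuantumFields.YangMills.Theorems.ColdStartUniversality

open MeasureTheory ProbabilityTheory Finset Filter Set Topology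
open scoped BigOperators NNReal ENNReal
open Literature.Probability.Process Literature.MathematicalPhysics.QuantumFieldTheory
open Literature.MathematicalPhysics.QuantumLattice (fundamentalRep fundamentalLatticeRep continuous_fundamentalRep)

variable {L : ℕ} [NeZero L]

/-- ★ **Left invariance of the single-link law**: for `x + e_μ ≠ x`, every `h ∈ SU(2)`, every `β'` and every continuous `φ`,
`∫ φ(V_e) dμ_{β'} = ∫ φ(h·V_e) dμ_{β'}` (gauge invariance of `μ_{β'}` under `γ = 1[x ↦ h]`). [folklore] -/
theorem integral_link_eq_integral_mul_left (β' : ℝ) {e : Edge 3 L} (hshift : e.1.shift e.2 ≠ e.1)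
    (h : Matrix.specialUnitaryGroup (Fin 2) ℂ) {φ : Matrix.specialUnitaryGroup (Fin 2) ℂ → ℝ} (hφ : Continuous φ) :
    ∫ V, φ (V e) ∂(wilsonMeasure (d := 3) (L := L) (fundamentalRep (Fin 2)) β') =
      ∫ V, φ (h * V e) ∂(wilsonMeasure (d := 3) (L := L) (fundamentalRep (Fin 2)) β') := by
  classical
  haveI := secondCountableTopology_su2
  haveI := borelSpace_config L
  set μ : Measure (GaugeConfig 3 L (Matrix.specialUnitaryGroup (Fin 2) ℂ)) :=
    wilsonMeasure (d := 3) (L := L) (fundamentalRep (Fin 2)) β' with hμ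
  set γ : Site 3 L → Matrix.specialUnitaryGroup (Fin 2) ℂ :=
    Function.update (fun _ => (1 : Matrix.specialUnitaryGroup (Fin 2) ℂ)) e.1 h with hγ
  have hmap : μ.map (gaugeTransform γ) = μ :=
    wilsonMeasure_map_gaugeTransform_holds (d := 3) (L := L) (fundamentalRep (Fin 2)) β' γ
  have hT : Measurable (gaugeTransform γ : GaugeConfig 3 L (Matrix.specialUnitaryGroup (Fin 2) ℂ) → _) := by
    have hc : Continuous (gaugeTransform γ : GaugeConfig 3 L (Matrix.specialUnitaryGroup (Fin 2) ℂ) → _) :=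
      continuous_pi fun e' => (continuous_const.mul (continuous_apply e')).mul continuous_const
    exact hc.measurable
  have hcont : Continuous fun V : GaugeConfig 3 L (Matrix.specialUnitaryGroup (Fin 2) ℂ) => φ (V e) :=
    hφ.comp (continuous_apply e)
  calc ∫ V, φ (V e) ∂μ = ∫ V, φ (V e) ∂(μ.map (gaugeTransform γ)) := by rw [hmap]
    _ = ∫ V, φ ((gaugeTransform γ V) e) ∂μ := integral_map hT.aemeasurable hcont.aestronglyMeasurable
    _ = ∫ V, φ (h * V e) ∂μ := by
        refine integral_congr_ae (Eventually.of_forall fun V => ?_)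
        simp only [hγ, gaugeTransform_update_apply hshift h V]

/-- ★★ **Single-link marginals of the Wilson measure are Haar** (`x + e_μ ≠ x`, every `β'`): `∫ φ(V_e) dμ_{β'}(V) = ∫ φ dHaar` for every
continuous `φ : SU(2) → ℝ` (average the left invariance over `h` w.r.t. Haar, Fubini, right invariance of Haar). [folklore] -/
theorem integral_link_eq_haar (β' : ℝ) {e : Edge 3 L} (hshift : e.1.shift e.2 ≠ e.1)
    {φ : Matrix.specialUnitaryGroup (Fin 2) ℂ → ℝ} (hφ : Continuous φ) :
    ∫ V, φ (V e) ∂(wilsonMeasure (d := 3) (L := L) (fundamentalRep (Fin 2)) β') =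
      ∫ g, φ g ∂(haarProbability (Matrix.specialUnitaryGroup (Fin 2) ℂ)) := by
  classical
  haveI := secondCountableTopology_su2
  haveI := borelSpace_config L
  haveI : IsProbabilityMeasure (haarProbability (Matrix.specialUnitaryGroup (Fin 2) ℂ)) := inferInstance
  haveI := YM2.isMulRightInvariant_haarProbability (Matrix.specialUnitaryGroup (Fin 2) ℂ)
  set μ : Measure (GaugeConfig 3 L (Matrix.specialUnitaryGroup (Fin 2) ℂ)) :=
    wilsonMeasure (d := 3) (L := L) (fundamentalRep (Fin 2)) β' with hμ
  haveI : IsProbabilityMeasure μ :=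
    isProbabilityMeasure_wilsonMeasure (d := 3) (L := L) (fundamentalRep (Fin 2)) (continuous_fundamentalRep (Fin 2)) β'
  set ν : Measure (Matrix.specialUnitaryGroup (Fin 2) ℂ) := haarProbability (Matrix.specialUnitaryGroup (Fin 2) ℂ) with hν
  -- the joint integrand `(h, V) ↦ φ(h·V_e)` is continuous on a compact product, hence integrable for `ν ⊗ μ`
  have hjoint : Continuous fun p : Matrix.specialUnitaryGroup (Fin 2) ℂ × GaugeConfig 3 L (Matrix.specialUnitaryGroup (Fin 2) ℂ) =>
      φ (p.1 * p.2 e) :=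
    hφ.comp (continuous_fst.mul ((continuous_apply e).comp continuous_snd))
  obtain ⟨M, -, hM⟩ := exists_abs_le_of_continuous_of_compactSpace hjoint
  have hint : Integrable (Function.uncurry fun (h : Matrix.specialUnitaryGroup (Fin 2) ℂ)
      (V : GaugeConfig 3 L (Matrix.specialUnitaryGroup (Fin 2) ℂ)) => φ (h * V e)) (ν.prod μ) := by
    refine Integrable.of_bound (μ := ν.prod μ) hjoint.measurable.aestronglyMeasurable M (Eventually.of_forall fun p => ?_)
    rw [Real.norm_eq_abs]
    exact hM p
  -- `∫ φ(V_e) dμ = ∫_h ∫_V φ(h V_e) dμ dν` (left invariance, `ν` a probability measure)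
  have h1 : ∫ V, φ (V e) ∂μ = ∫ h, ∫ V, φ (h * V e) ∂μ ∂ν := by
    have e1 : ∀ h : Matrix.specialUnitaryGroup (Fin 2) ℂ, ∫ V, φ (h * V e) ∂μ = ∫ V, φ (V e) ∂μ := fun h =>
      (integral_link_eq_integral_mul_left (L := L) β' hshift h hφ).symm
    simp_rw [e1]
    rw [integral_const, probReal_univ, one_smul]
  -- Fubini and right invariance of Haar: `∫_h φ(h V_e) dν = ∫ φ dν`
  rw [h1, integral_integral_swap hint]
  have e2 : ∀ V : GaugeConfig 3 L (Matrix.specialUnitaryGroup (Fin 2) ℂ), ∫ h, φ (h * V e) ∂ν = ∫ g, φ g ∂ν := fun V =>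
    integral_mul_right_eq_self (fun g => φ g) (V e)
  simp_rw [e2]
  rw [integral_const, probReal_univ, one_smul]

/-- ★ **Single-link expectations do not depend on the coupling**: `∫ φ(V_e) dμ_{β'} = ∫ φ(V_e) dμ_0` (`x + e_μ ≠ x`, continuous `φ`).
[folklore] -/
theorem integral_link_eq_beta_zero (β' : ℝ) {e : Edge 3 L} (hshift : e.1.shift e.2 ≠ e.1)
    {φ : Matrix.specialUnitaryGroup (Fin 2) ℂ → ℝ} (hφ : Continuous φ) :
    ∫ V, φ (V e) ∂(wilsonMeasure (d := 3) (L := L) (fundamentalRep (Fin 2)) β') =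
      ∫ V, φ (V e) ∂(wilsonMeasure (d := 3) (L := L) (fundamentalRep (Fin 2)) 0) := by
  rw [integral_link_eq_haar β' hshift hφ, integral_link_eq_haar 0 hshift hφ]

end Summit.QuantumFields.YangMills.Theorems.ColdStartUniversality

end
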